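import Mathlib
import Summits.Ventures.HodgeRepro2.Tier7.Line3.LevelFactorOfLocal
import Summits.Ventures.HodgeRepro2.Tier7.Line3.LevelTowerTopology
import Summits.Ventures.HodgeRepro2.Tier7.Line3.TorusCompact

/-!
# Tier7/Line3/ConcreteLevelFactor — the `b`-fields of `KappaData` on the CONCRETE model at the level place
(seat t7-x1, gen 3; the assembly of this generation's chain on p1's tori, the congruence tower and Mathlib's Haar measures)

LINE 3 (t7-plan-3), version (ii). Over a normed field `F` that is proper (a local field) and ultrametric, with a continuous
isometric involution `σ`, a unit `P` whose columns are the second basis `f`, and the second torus inside the integral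
matrices (`hB`): the tori `torusA σ`, `torusB σ f` are compact topological groups (TorusCompact p697465), second countable
(the units topology embeds into `F`, resp. `M₂(F) × M₂(F)ᵐᵒᵖ`; `secondCountable_torusA/B`), and carry Mathlib's Haar
measures (`MeasureTheory.Measure.haar`: finite on the compact space, open-positive, left-invariant); the level tower
`levelTower normAbv _ hq` is open (LevelTowerTopology p696895), antitone, with `⋂ = {1}` and normalised by the second
torus (CongruenceSubgroup p694858). So `LevelFactorData.ofLocal` (LevelFactorOfLocal p693983) applies with ONLY the
data-level facts displayed — the characters unitary and locally constant, the central match on the stabiliser of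
`loc γ₀`, the `N`-independent part `bS` with its three clauses — and the three `b`-fields of `KappaData` follow
(`concrete_kappaData_b_fields`), for a `LevelFactorData` whose tori, tower, representative, dominant coset and
`N`-independent data are the given ones; the σ-algebras are DISPLAYED as Borel and the measures as HAAR measures in the
conclusion (crit-1's question of record, STATUS l. 15715), so the consumer reads `D.b` as the orbital integrals for the
Haar measures. The support predicate of that data is the joint `arith` of JointSupport p696095.
DICTIONARY (in words): `F = E_{v₁}`, `σ` its involution, `f` / `P` the local second basis, `χA = μ_{A,v₁}`, `ψB = μ_{B,v₁}⁻¹`,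
`loc γ = (matO γ).map ψ` as a unit, (C) on the stabiliser, the places `≠ v₁` in `bS`. Nothing here is about (N), (P),
the real `X`, or HC_CM; §8(d): NO. Blind lane: Mathlib + the HodgeRepro2 prefix; no sorry;
axioms ⊆ {propext, Classical.choice, Quot.sound}.
-/

namespace Summit.Ventures.HodgeRepro2.Tier7.Line3.ConcreteLevelFactor

open MeasureTheory Topology Matrix
  Summit.Ventures.HodgeRepro2.Tier7.Line3.LevelInvariantOrbital
  Summit.Ventures.HodgeRepro2.Tier7.Line3.CongruenceSubgroup
  Summit.Ventures.HodgeRepro2.Tier7.Line3.TorusSupport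
  Summit.Ventures.HodgeRepro2.Tier7.Line3.TorusCompact
  Summit.Ventures.HodgeRepro2.Tier7.Line3.LevelTowerTopology
  Summit.Ventures.HodgeRepro2.Tier7.Line3.LevelFactor

variable {F : Type*} [NormedField F] [ProperSpace F] (σ : F →+* F)

/-! ## Second countability of the tori -/

/-- the units of a proper normed field are second countable (the coercion is an embedding). -/
theorem secondCountable_units : SecondCountableTopology Fˣ :=
  Units.isEmbedding_val₀.secondCountableTopology

/-- the first torus is second countable. -/
theorem secondCountable_torusA : SecondCountableTopology (torusA σ) := by
  haveI := secondCountable_units (F := F)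
  haveI : SecondCountableTopology (Fin 2 → Fˣ) := inferInstance
  exact Topology.IsEmbedding.subtypeVal.secondCountableTopology

/-- the multiplicative opposite of a second countable space is second countable. -/
theorem secondCountable_mulOpposite (X : Type*) [TopologicalSpace X] [SecondCountableTopology X] :
    SecondCountableTopology Xᵐᵒᵖ :=
  MulOpposite.opHomeomorph.symm.isEmbedding.secondCountableTopology

/-- `GL (Fin 2) F` is second countable (the units embed into `M₂(F) × M₂(F)ᵐᵒᵖ`). -/
theorem secondCountable_GL : SecondCountableTopology (GL (Fin 2) F) := by
  haveI := secondCountable_mulOpposite (Matrix (Fin 2) (Fin 2) F)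
  exact Units.isInducing_embedProduct.secondCountableTopology

/-- the second torus is second countable. -/
theorem secondCountable_torusB (f : Fin 2 → Fin 2 → F) : SecondCountableTopology (torusB σ f) := by
  haveI := secondCountable_GL (F := F)
  exact Topology.IsEmbedding.subtypeVal.secondCountableTopology

/-! ## Continuity of the torus embeddings -/

omit [ProperSpace F] in
/-- `iotaA σ` is continuous. -/
theorem continuous_iotaA : Continuous (iotaA σ) :=
  continuous_diagUnitHom.comp continuous_subtype_val

omit [ProperSpace F] in
/-- `iotaB σ f` is continuous. -/
theorem continuous_iotaB (f : Fin 2 → Fin 2 → F) : Continuous (iotaB σ f) :=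
  continuous_subtype_val

/-! ## The assembly on the concrete model -/

/-- **the three `b`-fields of `KappaData` on the concrete model**: with Borel σ-algebras and Haar measures on the two
compact tori, the level tower `K_{q⁻¹^(N+1)}`, and only the data-level facts displayed, there is a `LevelFactorData` on
p1's tori with the given representative / dominant coset / `N`-independent data whose `b`-fields hold. -/
theorem concrete_kappaData_b_fields [IsUltrametricDist F] (hσc : Continuous σ) (hσn : ∀ x, ‖σ x‖ = ‖x‖)
    (f : Fin 2 → Fin 2 → F) (P : GL (Fin 2) F) (hP : ∀ j, (P : Matrix (Fin 2) (Fin 2) F).col j = f j)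
    {q : ℝ} (hq : 1 < q)
    (hB : ∀ b : torusB σ f, EntryLE normAbv 1 ((iotaB σ f b : GL (Fin 2) F) : Matrix (Fin 2) (Fin 2) F))
    (hB' : ∀ b : torusB σ f, EntryLE normAbv 1 (((iotaB σ f b)⁻¹ : GL (Fin 2) F) : Matrix (Fin 2) (Fin 2) F))
    {Orb : Type*} (χA : torusA σ →* ℂ) (ψB : torusB σ f →* ℂ) (hχA : ∀ a, ‖χA a‖ = 1)
    (hψB : ∀ b, ‖ψB b‖ = 1) (hχA' : IsLocallyConstant (χA : torusA σ → ℂ))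
    (hψB' : IsLocallyConstant (ψB : torusB σ f → ℂ)) (loc : Orb → GL (Fin 2) F) (γ₀ : Orb)
    (hmatch : ∀ a b, (iotaA σ a)⁻¹ * loc γ₀ * iotaB σ f b = loc γ₀ → χA a * ψB b = 1)
    (arithS : Orb → Prop) (bS : Orb → ℂ) (bS_support : ∀ γ, bS γ ≠ 0 → arithS γ) (C : ℝ) (size : Orb → ℝ)
    (ε : ℝ) (bS_bound : ∀ γ, arithS γ → ‖bS γ‖ ≤ C * (1 + size γ) ^ ε * ‖bS γ₀‖) (bS_γ₀ : bS γ₀ ≠ 0) :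
    ∃ (mA : MeasurableSpace (torusA σ)) (mB : MeasurableSpace (torusB σ f))
      (μA : Measure (torusA σ)) (μB : Measure (torusB σ f))
      (D : LevelFactorData (torusA σ) (torusB σ f) (GL (Fin 2) F) Orb μA μB),
      (@BorelSpace (torusA σ) _ mA) ∧ (@BorelSpace (torusB σ f) _ mB) ∧
      μA.IsHaarMeasure ∧ μB.IsHaarMeasure ∧
      D.ιA = iotaA σ ∧ D.ιB = iotaB σ f ∧ D.K = levelTower normAbv isNonarchimedean_normAbv hq ∧
      D.loc = loc ∧ D.γ₀ = γ₀ ∧ D.arithS = arithS ∧ D.bS = bS ∧ D.size = size ∧ D.ε = ε ∧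
      (∀ N γ, D.b N γ ≠ 0 → D.arith N γ) ∧
      (∃ Bb : ℝ, ∀ N γ, D.arith N γ → ‖D.b N γ‖ ≤ Bb * (1 + D.size γ) ^ D.ε * ‖D.b N D.γ₀‖) ∧
      (∃ N₀ : ℕ, ∀ N ≥ N₀, D.b N D.γ₀ ≠ 0) := by
  haveI hcA : CompactSpace (torusA σ) := compactSpace_torusA σ hσc hσn
  haveI hcB : CompactSpace (torusB σ f) := compactSpace_torusB σ f P hσc hσn hP
  haveI hsA : SecondCountableTopology (torusA σ) := secondCountable_torusA σ
  haveI hsB : SecondCountableTopology (torusB σ f) := secondCountable_torusB σ f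
  letI mA : MeasurableSpace (torusA σ) := borel _
  haveI hbA : BorelSpace (torusA σ) := ⟨rfl⟩
  letI mB : MeasurableSpace (torusB σ f) := borel _
  haveI hbB : BorelSpace (torusB σ f) := ⟨rfl⟩
  let μA : Measure (torusA σ) := Measure.haar
  let μB : Measure (torusB σ f) := Measure.haar
  haveI : IsFiniteMeasure μA := CompactSpace.isFiniteMeasure
  haveI : IsFiniteMeasure μB := CompactSpace.isFiniteMeasure
  let D : LevelFactorData (torusA σ) (torusB σ f) (GL (Fin 2) F) Orb μA μB :=
    LevelFactorData.ofLocal μA μB (iotaA σ) (iotaB σ f) (continuous_iotaA σ) (continuous_iotaB σ f) χA ψB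
      hχA hψB hχA' hψB' (levelTower normAbv isNonarchimedean_normAbv hq)
      (normalizes_levelTower normAbv isNonarchimedean_normAbv hq (iotaB σ f) hB hB')
      (isOpen_levelTower hq) (levelTower_antitone normAbv isNonarchimedean_normAbv hq)
      (eq_one_of_forall_mem_levelTower normAbv isNonarchimedean_normAbv hq) loc γ₀ hmatch arithS bS
      bS_support C size ε bS_bound bS_γ₀
  refine ⟨mA, mB, μA, μB, D, hbA, hbB, inferInstance, inferInstance, rfl, rfl, rfl, rfl, rfl, rfl, rfl, rfl, rfl,
    ?_⟩
  exact LevelFactorData.kappaData_b_fields D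

end Summit.Ventures.HodgeRepro2.Tier7.Line3.ConcreteLevelFactor
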